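import Literature.AnabelianGeometry.SemiGraphs.FiniteEtaleCoveringDictionary
import Literature.AnabelianGeometry.SemiGraphs.GraphOfAnabelioidsGalois
import Literature.AnabelianGeometry.Anabelioids.ComponentsOrbits
import HarnessLib

/-!
# The finite étale covering dictionary ([SemiAnbd] §2) — proof of (D2), vertices over `v`

Mochizuki, *Semi-graphs of anabelioids*, Publ. RIMS **42** (2006), §2 p. 23 ("the vertices of `𝒢′`
that lie over `v` [are] the connected components of `S_v`") and Remark 2.2.1 p. 24 (stabilisers /
decomposition groups).  abc-iut cell, layer L3, DISCHARGE-L3 §G row G30, fact (D2)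
`covering_vertexFibre_doubleCosets` of abc-iut-L3-d3's `FiniteEtaleCoveringDictionary.lean`.

PROOF-ONLY file (abc-iut-L6-d4; no definitions):

* `isConnected_of_isGlobalCovering` — a connected covering is attached to a CONNECTED object
  (`B(𝒢′) ≃ B(𝒢)_{/A}` Galois ⇒ `A` connected);
* `covering_vertexFibre_doubleCosets_core` — the counting bijection
  {vertices of `𝒢′` over `v`} ≃ `Π_v \ Π_𝒢 / Π′` with the base vertex on the class of `1`, under the
  local + global clauses, the identification `Π′ = Stab(x₀)` and the VERTEX-ALIGNMENT clauses (ruling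
  ρ2: `Hom.IsVertexAligned`, here unfolded as `hV3`/`hV4` so that the file does not depend on the
  pending statement files); the `_holds` wrapper for the dictionary's (v3) text follows when that text
  lands.

Inputs: abc-iut-L3-t1's local predicate (`cV` bijection), abc-iut-L3-t9's `galoisCategory_bObj` /
`fiberFunctor_ρ`, abc-iut-L6-t17's `ComponentsOrbits` (components of `A_v` are the `Aut F`-orbits of
`F(A_v)`), Mathlib's transitivity of `Aut F` on the fibre of a connected object and `DoubleCoset`.
Nothing here takes a side on [IUTchIII] Cor. 3.12; typed ≠ discharged.
-/

namespace Literature.AnabelianGeometry.SemiGraphs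

open CategoryTheory CategoryTheory.Limits CategoryTheory.PreGaloisCategory
open Literature.AnabelianGeometry.Anabelioids
open scoped Pointwise

universe v₁ u₁ u

namespace SemiGraphOfAnabelioids

variable {𝒢 𝒢' : SemiGraphOfAnabelioids.{v₁, u₁, u}}

/-- **The object a connected covering is attached to is connected**: if `φ : 𝒢′ → 𝒢` is GLOBALLY
the covering attached to `A` (`B(𝒢′) ≃ B(𝒢)_{/A}` via `φ^*` — the common body of abc-iut-L3-d3's
`Hom.IsBObjCoveringOf` / `Hom.IsGlobalCoveringOf`, taken here in unfolded form so that either name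
applies) and `𝒢′` is connected, then `A` is a connected object of `B(𝒢)`: the terminal object
`(A = A)` of `B(𝒢)_{/A}` goes to the terminal object of the Galois category `B(𝒢′)`, which is
connected, and the equivalence reflects initial objects and isomorphisms of subobjects.
[cite: MochizukiSemiAnbd2006, Def. 2.2(i) p.23] -/
theorem isConnected_of_isGlobalCovering (h𝒢' : 𝒢'.IsConnected) (φ : Hom 𝒢' 𝒢) (A : 𝒢.BObj)
    (hB : ∃ (_ : HasBinaryProducts 𝒢.BObj) (α : Over A ⥤ 𝒢'.BObj),
      α.IsEquivalence ∧ Nonempty (φ.pullbackFunctor ≅ Over.star A ⋙ α)) :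
    PreGaloisCategory.IsConnected A := by
  obtain ⟨_, α, hα, ⟨_⟩⟩ := hB
  haveI := hα
  letI := 𝒢'.preGaloisCategory_bObj
  letI := 𝒢'.galoisCategory_bObj h𝒢'
  have hT : IsTerminal (α.obj (Over.mk (𝟙 A))) := Over.mkIdTerminal.isTerminalObj α _
  haveI : PreGaloisCategory.IsConnected (α.obj (Over.mk (𝟙 A))) :=
    haveI := isConnected_terminal (C := 𝒢'.BObj)
    isConnected_of_iso (terminalIsTerminal.uniqueUpToIso hT)
  have hrefl : ∀ (Z : Over A), IsInitial (α.obj Z) → IsInitial Z.left := by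
    intro Z hZ
    have h1 : IsInitial (α.inv.obj (α.obj Z)) := hZ.isInitialObj α.inv _
    have h2 : IsInitial Z := h1.ofIso (α.asEquivalence.unitIso.app Z).symm
    refine IsInitial.ofUniqueHom
      (fun W => ((Over.forgetAdjStar A).homEquiv Z W).symm (h2.to _)) fun W m => ?_
    apply ((Over.forgetAdjStar A).homEquiv Z W).injective
    rw [Equiv.apply_symm_apply]
    exact h2.hom_ext _ _
  constructor
  · intro hA
    have hI : IsInitial (Over.mk (𝟙 A)) :=
      IsInitial.ofUniqueHom (fun Y => Over.homMk (hA.to Y.left) (hA.hom_ext _ _))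
        fun Y m => Over.OverMorphism.ext (hA.hom_ext _ _)
    exact PreGaloisCategory.IsConnected.notInitial (hI.isInitialObj α _)
  · intro Y i hi hY
    let u : Over.mk i ⟶ Over.mk (𝟙 A) := Over.homMk i (Category.comp_id i)
    haveI : Mono u.left := by change Mono i; exact hi
    haveI : Mono u := Over.mono_of_mono_left u
    have hne : IsInitial (α.obj (Over.mk i)) → False := fun hI => hY (hrefl (Over.mk i) hI)
    haveI : Mono (α.map u) := α.map_mono u
    haveI : IsIso (α.map u) := PreGaloisCategory.IsConnected.noTrivialComponent _ (α.map u) hne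
    haveI : IsIso u := isIso_of_fully_faithful α u
    show IsIso ((Over.forget A).map u)
    infer_instance

/-- **(D2) core — the vertices of the covering over `v` ↔ the double cosets `Π_v \ Π_𝒢 / Π′`**
([SemiAnbd] §2 p. 23: "the vertices of `𝒢′` that lie over `v` [are] the connected components of
`S_v`"; Rem. 2.2.1 p. 24), for a connected finite étale covering `φ : 𝒢′ → 𝒢` attached to `A` locally
(`IsFiniteEtaleCoveringOf`: the vertices over `v` are labelled bijectively by `π₀(A_v)`) and globally
(`B(𝒢′) ≃ B(𝒢)_{/A}`, unfolded form), with `Π′ = ι(Π_{𝒢′}) = Stab(x₀)`: there is `d` on the vertices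
over `v` inducing a BIJECTION onto `Π_v \ Π_𝒢 / Π′` with `d(v′) ∈ Π′` — by COUNTING: vertices over
`v` ≃ `π₀(A_v)` (local clause) ≃ `Π_v`-orbits on the fibre `F(A_v)` (components are orbits,
abc-iut-L6-t17 `ComponentsOrbits`) ≃ `Π_v \ Π_𝒢 / Stab(x₀)` (`Π_𝒢` acts transitively on `F(A_v)`
since `A` is connected, `isConnected_of_isGlobalCovering`), then a transposition puts the base vertex
on the class of `1`.  The two GROUP clauses — `ι(Π_{v′}) = Π′ ∩ Π_v` and "every verticial subgroup
over `v` is a decomposition group `Π′ ∩ g⁻¹ Π_v g`" — are exactly the VERTEX ALIGNMENT of the covering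
(abc-iut-L6-d4 `Hom.IsVertexAligned`, ruling ρ2; they are not consequences of the local + global
clauses) and are taken as hypotheses `hV3`, `hV4` in unfolded form.  HONEST LIMIT: which double coset
belongs to which vertex is not asserted (pure group data cannot see the component labelling).
[cite: MochizukiSemiAnbd2006, Rem. 2.2.1 p.24] -/
theorem covering_vertexFibre_doubleCosets_core (h𝒢 : 𝒢.IsConnected) (h𝒢' : 𝒢'.IsConnected)
    (φ : Hom 𝒢' 𝒢) (A : 𝒢.BObj) (hloc : φ.IsFiniteEtaleCoveringOf A)
    (hB : ∃ (_ : HasBinaryProducts 𝒢.BObj) (α : Over A ⥤ 𝒢'.BObj),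
      α.IsEquivalence ∧ Nonempty (φ.pullbackFunctor ≅ Over.star A ⋙ α))
    (v' : 𝒢'.graph.Vertex) (F' : 𝒢'.V v' ⥤ FintypeCat.{v₁}) [FiberFunctor F']
    (F : 𝒢.V (φ.base.vertexMap v') ⥤ FintypeCat.{v₁}) [FiberFunctor F]
    (e : (φ.φV v').pullback ⋙ F' ≅ F)
    (hV3 : ((Aut.autMulEquivOfIso (Functor.isoWhiskerLeft (𝒢.ρ (φ.base.vertexMap v')) e)
              ).toMonoidHom.comp (pi1Map φ.pullbackFunctor (𝒢'.ρ v' ⋙ F'))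
            |>.comp (𝒢'.piVToPi v' F')).range =
          ((Aut.autMulEquivOfIso (Functor.isoWhiskerLeft (𝒢.ρ (φ.base.vertexMap v')) e)
              ).toMonoidHom.comp (pi1Map φ.pullbackFunctor (𝒢'.ρ v' ⋙ F'))).range ⊓
            (𝒢.piVToPi (φ.base.vertexMap v') F).range)
    (hV4 : ∀ (v'' : {v'' : 𝒢'.graph.Vertex // φ.base.vertexMap v'' = φ.base.vertexMap v'})
        (F'' : 𝒢'.V v''.1 ⥤ FintypeCat.{v₁}) [FiberFunctor F'']
        (α : 𝒢'.ρ v''.1 ⋙ F'' ≅ 𝒢'.ρ v' ⋙ F'),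
        ∃ g : 𝒢.Pi (φ.base.vertexMap v') F,
          (((Aut.autMulEquivOfIso (Functor.isoWhiskerLeft (𝒢.ρ (φ.base.vertexMap v')) e)
              ).toMonoidHom.comp (pi1Map φ.pullbackFunctor (𝒢'.ρ v' ⋙ F'))).comp
              ((Aut.autMulEquivOfIso α).toMonoidHom.comp (𝒢'.piVToPi v''.1 F''))).range =
            ((Aut.autMulEquivOfIso (Functor.isoWhiskerLeft (𝒢.ρ (φ.base.vertexMap v')) e)
              ).toMonoidHom.comp (pi1Map φ.pullbackFunctor (𝒢'.ρ v' ⋙ F'))).range ⊓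
              ConjAct.toConjAct g⁻¹ • (𝒢.piVToPi (φ.base.vertexMap v') F).range)
    (x₀ : (𝒢.ρ (φ.base.vertexMap v') ⋙ F).obj A)
    (hx₀ : ((Aut.autMulEquivOfIso (Functor.isoWhiskerLeft (𝒢.ρ (φ.base.vertexMap v')) e)
              ).toMonoidHom.comp (pi1Map φ.pullbackFunctor (𝒢'.ρ v' ⋙ F'))).range =
          MulAction.stabilizer (𝒢.Pi (φ.base.vertexMap v') F) x₀) :
    let v := φ.base.vertexMap v'
    let ι : 𝒢'.Pi v' F' →* 𝒢.Pi v F :=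
      (Aut.autMulEquivOfIso (Functor.isoWhiskerLeft (𝒢.ρ v) e)).toMonoidHom.comp
        (pi1Map φ.pullbackFunctor (𝒢'.ρ v' ⋙ F'))
    let Pv : Subgroup (𝒢.Pi v F) := (𝒢.piVToPi v F).range
    ∃ d : {v'' : 𝒢'.graph.Vertex // φ.base.vertexMap v'' = v} → 𝒢.Pi v F,
      Function.Bijective (fun v'' => DoubleCoset.mk Pv ι.range (d v'')) ∧
      d ⟨v', rfl⟩ ∈ ι.range ∧
      (ι.comp (𝒢'.piVToPi v' F')).range = ι.range ⊓ Pv ∧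
      ∀ (v'' : {v'' : 𝒢'.graph.Vertex // φ.base.vertexMap v'' = v})
        (F'' : 𝒢'.V v''.1 ⥤ FintypeCat.{v₁}) [FiberFunctor F'']
        (α : 𝒢'.ρ v''.1 ⋙ F'' ≅ 𝒢'.ρ v' ⋙ F'),
        ∃ g : 𝒢.Pi v F,
          (ι.comp ((Aut.autMulEquivOfIso α).toMonoidHom.comp (𝒢'.piVToPi v''.1 F''))).range =
            ι.range ⊓ ConjAct.toConjAct g⁻¹ • Pv := by
  intro v ι Pv
  classical
  letI := 𝒢.preGaloisCategory_bObj
  letI := 𝒢.galoisCategory_bObj h𝒢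
  -- notation and instances
  let K : 𝒢.BObj ⥤ FintypeCat.{v₁} := 𝒢.ρ v ⋙ F
  haveI : FiberFunctor K := 𝒢.fiberFunctor_ρ h𝒢 v F
  haveI : PreGaloisCategory.IsConnected A := isConnected_of_isGlobalCovering h𝒢' φ A hB
  haveI : MulAction.IsPretransitive (𝒢.Pi v F) (K.obj A) :=
    FiberFunctor.isPretransitive_of_isConnected K A
  -- `Pv` acts on `K(A) = F(A_v)` through `Aut F`
  have hPv_smul : ∀ (u : Aut F) (y : F.obj (A.S v)),
      (𝒢.piVToPi v F u) • (show K.obj A from y) = (show K.obj A from u • y) := fun u y => rfl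
  -- the vertices over `v` ↔ the connected components of `A_v` (local predicate)
  obtain ⟨-, cV, -, hbijV, -⟩ := hloc
  let S := {v'' : 𝒢'.graph.Vertex // φ.base.vertexMap v'' = v}
  let fS : S → π₀Obj (A.S v) := fun w => cast (congrArg (fun x => π₀Obj (A.S x)) w.2) (cV w.1)
  have hfS : ∀ w : S, (⟨φ.base.vertexMap w.1, cV w.1⟩ : Σ x, π₀Obj (A.S x)) = ⟨v, fS w⟩ :=
    fun w => Sigma.mk.inj_iff.mpr ⟨w.2, (cast_heq _ _).symm⟩
  have hfS_inj : Function.Injective fS := by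
    intro w₁ w₂ h
    have h' := (hfS w₁).trans ((congrArg (Sigma.mk v) h).trans (hfS w₂).symm)
    exact Subtype.ext (hbijV.1 h')
  have hfS_surj : Function.Surjective fS := by
    intro P
    obtain ⟨w, hw⟩ := hbijV.2 ⟨v, P⟩
    have hw1 : φ.base.vertexMap w = v := congrArg Sigma.fst hw
    refine ⟨⟨w, hw1⟩, ?_⟩
    have h2 := (hfS ⟨w, hw1⟩).symm.trans hw
    exact eq_of_heq (Sigma.mk.inj_iff.mp h2).2
  -- the components of `A_v` ↔ the double cosets `Pv \ Π / Π′`: pick a point of each component and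
  -- an element of `Π` moving `x₀` to it
  have hpt : ∀ P : π₀Obj (A.S v), ∃ y : F.obj (A.S v), y ∈ Set.range (F.map P.1.arrow) := by
    intro P
    haveI : PreGaloisCategory.IsConnected (P.1 : 𝒢.V v) := P.2
    obtain ⟨p⟩ := nonempty_fiber_of_isConnected F (P.1 : 𝒢.V v)
    exact ⟨F.map P.1.arrow p, p, rfl⟩
  choose yP hyP using hpt
  have hgt : ∀ P : π₀Obj (A.S v), ∃ g : 𝒢.Pi v F, g • x₀ = (show K.obj A from yP P) := fun P =>
    MulAction.exists_smul_eq (𝒢.Pi v F) x₀ _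
  choose gP hgP using hgt
  let cP : π₀Obj (A.S v) → DoubleCoset.Quotient (Pv : Set (𝒢.Pi v F)) ι.range :=
    fun P => DoubleCoset.mk Pv ι.range (gP P)
  -- two elements of `Π` lie in the same double coset iff they move `x₀` into the same `Pv`-orbit
  have hkey : ∀ g₁ g₂ : 𝒢.Pi v F, DoubleCoset.mk Pv ι.range g₁ = DoubleCoset.mk Pv ι.range g₂ ↔
      ∃ u : Aut F, g₂ • x₀ = (show K.obj A from u • (show F.obj (A.S v) from g₁ • x₀)) := by
    intro g₁ g₂
    rw [DoubleCoset.eq]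
    constructor
    · rintro ⟨h, hh, k, hk, rfl⟩
      obtain ⟨u, rfl⟩ := hh
      rw [hx₀] at hk
      refine ⟨u, ?_⟩
      rw [mul_smul, mul_smul, MulAction.mem_stabilizer_iff.mp hk, hPv_smul]
    · rintro ⟨u, hu⟩
      refine ⟨𝒢.piVToPi v F u, ⟨u, rfl⟩, (𝒢.piVToPi v F u * g₁)⁻¹ * g₂, ?_,
        (mul_inv_cancel_left _ _).symm⟩
      rw [hx₀, MulAction.mem_stabilizer_iff, mul_smul, inv_smul_eq_iff, mul_smul, hPv_smul]
      exact hu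
  have hcP_inj : Function.Injective cP := by
    intro P Q h
    obtain ⟨u, hu⟩ := (hkey _ _).mp h
    rw [hgP, hgP] at hu
    have hQ : yP Q ∈ Set.range (F.map P.1.arrow) := by
      rw [range_map_arrow_eq_orbit F P (hyP P)]
      exact ⟨u, hu.symm⟩
    exact component_eq_of_mem_range F P Q hQ (hyP Q)
  have hcP_surj : Function.Surjective cP := by
    intro q
    have hq : DoubleCoset.mk Pv ι.range q.out = q := DoubleCoset.out_eq' _ _ q
    obtain ⟨P, hP⟩ :=
      exists_component_mem_range F (X := A.S v) (show F.obj (A.S v) from q.out • x₀)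
    refine ⟨P, ?_⟩
    rw [← hq]
    show DoubleCoset.mk Pv ι.range (gP P) = DoubleCoset.mk Pv ι.range q.out
    rw [hkey, hgP]
    have hmem : (show F.obj (A.S v) from q.out • x₀) ∈ MulAction.orbit (Aut F) (yP P) := by
      rw [← range_map_arrow_eq_orbit F P (hyP P)]
      exact hP
    obtain ⟨u, hu⟩ := hmem
    exact ⟨u, hu.symm⟩
  -- assemble: a bijection onto the double cosets sending the base vertex to the class of `1`
  let w₀ : S := ⟨v', rfl⟩
  let e₀ : S → DoubleCoset.Quotient (Pv : Set (𝒢.Pi v F)) ι.range := fun w => cP (fS w)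
  have he₀ : Function.Bijective e₀ :=
    ⟨hcP_inj.comp hfS_inj, hcP_surj.comp hfS_surj⟩
  let σ : Equiv.Perm (DoubleCoset.Quotient (Pv : Set (𝒢.Pi v F)) ι.range) :=
    Equiv.swap (e₀ w₀) (DoubleCoset.mk Pv ι.range 1)
  let e₁ : S → DoubleCoset.Quotient (Pv : Set (𝒢.Pi v F)) ι.range := fun w => σ (e₀ w)
  have he₁ : Function.Bijective e₁ := σ.bijective.comp he₀
  have he₁w₀ : e₁ w₀ = DoubleCoset.mk Pv ι.range 1 := Equiv.swap_apply_left _ _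
  let d : S → 𝒢.Pi v F := fun w => if w = w₀ then 1 else (e₁ w).out
  have hd : ∀ w, DoubleCoset.mk Pv ι.range (d w) = e₁ w := by
    intro w
    by_cases hw : w = w₀
    · rw [hw, he₁w₀]
      simp only [d, if_pos rfl]
    · simp only [d, if_neg hw]
      exact DoubleCoset.out_eq' _ _ _
  refine ⟨d, ?_, ?_, hV3, fun v'' F'' _ α => hV4 v'' F'' α⟩
  · have hfun : (fun w => DoubleCoset.mk Pv ι.range (d w)) = e₁ := funext hd
    rw [hfun]
    exact he₁
  · show (if w₀ = w₀ then (1 : 𝒢.Pi v F) else (e₁ w₀).out) ∈ ι.range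
    rw [if_pos rfl]
    exact one_mem _

end SemiGraphOfAnabelioids

end Literature.AnabelianGeometry.SemiGraphs
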